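import Summits.BirchSwinnertonDyer.Rank1Residual.Supersingular.X8KimLargeImageOPEN
import Literature.NumberTheory.EllipticCurves.Rank1Residual.Typed.X6
import Literature.NumberTheory.EllipticCurves.Rank1Residual.Typed.X7
import HarnessLib

/-!
# Good reduction at `3` with `E[3]` irreducible, under the `3`-adic tower — classes X7@3 / X6@3
# (`a_3 = 0`) as well as X8: `BSD(E,3)` in analytic rank `0` and `Ш(E/ℚ)[3^∞] = 0` in analytic rank
# `1` from ONE unit Kurihara number, CONDITIONAL on the announced Kim 2025 (arXiv:2505.09121, PREPRINT)
# structure theorem (cell `b2b-bsdres`, supersingular family, prover B = unit `b2b-bsdres-additive-p3`,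
# gen 17; X7 joint with prover A = `b2b-bsdres-x10b`; CLASS-CLOSURE §3.11 N5/O4 at `p = 3`, §3.16 N4@3)

HONEST FRAMING (run/shared/lean/b2b/bsd-rank1-residual/, verbatim in every file): the goal of the
cell is to DELETE the COMBINATION-SHAPED residual classes of the Birch–Swinnerton-Dyer formula for
ALL analytic-rank `≤ 1` elliptic curves over `ℚ` — "full BSD formula for every rank `≤ 1` curve in
class `C`" assembled STRICTLY from published theorems — so that the rank-`≤ 1` remainder becomes
exactly the CONSTRUCTION-SHAPED classes, which are TYPED (missing-input `Prop`s), NOT attempted.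
This is not "finishing BSD". Research route; no claim beyond the stated classes. X6 / X7 / X8 stay
CONSTRUCTION-SHAPED; per pair only; nothing about any curve is asserted; nothing is booked; no mark
of RESIDUAL-MAP §I moves. An ANNOUNCED preprint enters ONLY as an explicitly labelled OPEN
hypothesis: every theorem carrying `hKim25u` / `hKim25r : Kim2025.…_OPEN` is CONDITIONAL on the
unrefereed arXiv:2505.09121v1 (C.-H. Kim, app. R. Pollack, 2025); its `p = 3` Kolyvagin-system
input, Sakamoto, JTNB 36 (2024), IS refereed. Theorems only; no definition, no named fact (debt 0).

## Why this file

The cell's Kurihara consumers on the supersingular axis — x10b's `Supersingular/X7KuriharaRoute.lean`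
(p ≥ 5, Kim 2026 PUBLISHED) — stop at `p ≥ 5`; the `p = 3` rows of X7 (N5@3 = 221 r0 cells, O4@3 =
1 436 r1 cells on R196) and of X6 (N4@3 = 19) had no Kurihara reading. The sibling file
`X8KimLargeImageOPEN.lean` (p251694) showed that n1011-p09's OPEN `Prop`s of Kim 2025 (p249366: every
`p ≥ 3`, LARGE `p`-adic image, ANY reduction at `p`) apply at a GOOD `3` with the period transfer and
the Manin binder DISCHARGED by published facts. Nothing there used `a_3 ≠ 0`: the same holds for every
globally minimal `W` with good reduction at `3` and `E[3]` irreducible — automatic on X7 / X6 / X8 at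
`3` by Serre 1972 Prop. 12 (`ClassX7.irr`, `ClassX6.irr`, `ClassX8.irr`). This file states the
CLASS-AGNOSTIC core at `3` and reads it on X7@3 and X6@3, with the `3`-adic tower fed per pair by
surj(3) + (ram@3) (`towerSurj_of_surj_of_ram`, p249251; gen-16 census: (ram@3) on 2 842 / 3 328 X7@3
S-b pairs), by surj(3) + ONE Frobenius mod `9` (`towerSurj_of_frobenius_of_eq_three`, p250381), or —
on semistable X6 — by modularity + Ribet–Diamond level-lowering with NO certificate
(`ram_of_semistable_of_irr_of_le_seven` + `ClassX6.surj`).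

## Contents (all per pair)
* §0 `GoodThree.*` (good `3`, `Irr W 3`, tower): `periodTransfer`, `not_three_dvd_maninConstant_of_…`,
  r0 exact boundary `bsdp_iff_not_dvd_tamagawaProduct_…` and `bsdp_of_…` (`3 ∤ ∏ c_ℓ`), r1
  `card_sha_eq_one_…` and `bsdp_iff_padicValRat_eq_zero_…`.
* §1 X7@3: `X7.bsdp_three_of_kim2025_OPEN_of_kuriharaUnitAt_of_ram / _of_frobenius` (r0),
  `X7.card_sha_three_eq_one_of_kim2025_OPEN_of_kuriharaUnitPrimeAt_of_ram / _of_frobenius` (r1).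
* §2 X6@3 (semistable, `a_3 = 0`): `X6.bsdp_three_of_kim2025_OPEN_of_kuriharaUnitAt_of_levelLowering`
  (r0), `X6.card_sha_three_eq_one_of_kim2025_OPEN_of_kuriharaUnitPrimeAt_of_levelLowering` (r1).
Census pointers (obsanat `class-closure/{N5,O4,N4}/pairs.tsv`, the files' numbers): N5@3 221 = surj 109
(99 with `3 ∤ ∏ c_ℓ`) + 3Nn 112; O4@3 1 436 = surj 1 407 (97 with `3 ∤ ∏ c_ℓ`, 65 of them with
`ord₃ #Ш_an = 0`) + 3Nn 29; N4@3 19 surj (18 with `3 ∤ ∏ c_ℓ`). NOT claimed: no class theorem; Tam rows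
need level-`𝒩₂` numbers (not typed); 3Nn rows have no lever here.

References: [Kim2025RefinedTNC] Thm. 1.1, 1.2 (rk0), Cor. 1.7, §3.2.2; [Sakamoto2024KolyvaginThree]
Thm. 1.1; [CesnaviciusNeururerSaha2023] Thm. 1.2; Greenberg–Vatsal 2000 Rem. 3.4; Serre 1972 Prop. 12
/ 21; Ribet 1990 / Diamond 1995; [Miller2011LMS] Def. 1.1.
-/

noncomputable section

open scoped Classical MatrixGroups ModularForm

open CongruenceSubgroup WeierstrassCurve Literature.NumberTheory.EllipticCurves
  Literature.NumberTheory.EllipticCurves.ModularForms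
  Literature.NumberTheory.EllipticCurves.Rank1Residual
  Literature.NumberTheory.EllipticCurves.Rank1Residual.Typed
  Summit.BirchSwinnertonDyer.Rank1Residual.Additive

namespace Summit.BirchSwinnertonDyer.Rank1Residual.Supersingular

variable (W : WeierstrassCurve ℚ) [W.IsElliptic] [W.IsGloballyMinimal] [hp3 : Fact (Nat.Prime 3)]

/-! ### §0 The class-agnostic core at a GOOD `3` with `E[3]` irreducible -/

/-- **Period transfer at a good `3` with `E[3]` irreducible** — the PUBLISHED named fact
`realPeriodRat_eq_unit_mul_plusPeriod_three` (Greenberg–Vatsal 2000 Rem. 3.4 + Mazur 1978 Cor. 4.1 +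
Edixhoven 1991 Prop. 2), in the binder shape of the Kim `Prop`s. [cite: GreenbergVatsal2000, §3, Remark 3.4]
[cite: Mazur1978, Cor. 4.1] -/
theorem GoodThree.periodTransfer (h3per : realPeriodRat_eq_unit_mul_plusPeriod_three)
    (hgood : W.HasGoodReductionAtPrime 3) (hirr : Irr W 3)
    {N : ℕ} [NeZero N] (f : CuspForm (Gamma0 N) 2) (hf : IsNewformOf W f) :
    ∃ u : ℚ, ‖(u : ℚ_[3])‖ = 1 ∧ W.realPeriodRat = u * plusPeriod f :=
  h3per W hgood hirr f hf

/-- **`f₃ = 0` at a good `3`**, hence the Manin binder from the degree: for a conductor-level datum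
`D` with `3 ∤ deg(D)`, `3 ∤ c(D)` (Česnavičius–Neururer–Saha 2024 Thm. 1.2, named fact `hCNS` = A159;
the printed exceptional clause needs `val_3(N) ≥ 3`). ANY member of the isogeny class.
[cite: CesnaviciusNeururerSaha2023, Thm. 1.2] [cite: Silverman1994, IV.10.2(a)] -/
theorem GoodThree.not_three_dvd_maninConstant_of_not_dvd_modularDegree
    (hCNS : cesnaviciusNeururerSaha_padicVal_maninConstant_le_modularDegree)
    (hgood : W.HasGoodReductionAtPrime 3)
    [NeZero (W.conductorNorm ℤ)] (D : ModularParametrizationData W (W.conductorNorm ℤ))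
    (hdeg : ¬ 3 ∣ D.modularDegree) : ¬ (3 : ℤ) ∣ D.maninConstant := by
  have hv : W.HasGoodReductionAt (placeOf 3) :=
    (W.hasGoodReductionAtPrime_iff_hasGoodReductionAt_holds ⟨3, Nat.prime_three⟩).mp hgood
  have h0 : condExp W 3 = 0 := conductorExponent_eq_zero_of_hasGoodReductionAt (placeOf 3) W hv
  exact not_three_dvd_maninConstant_of_condExp_le_two_of_not_dvd_modularDegree hCNS W D
    (by rw [h0]; norm_num) hdeg

/-- **Good `3`, `E[3]` irreducible, `r_an = 0`, `3`-adic tower: `BSD(E,3) ⟺ 3 ∤ ∏ c_ℓ` given ONE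
unit Kurihara number at a cyclic level** (`X4.KuriharaUnitAt W 3 D.f`), CONDITIONAL on the announced
Kim 2025 Thm. 1.1 / Cor. 1.7 unit clause (`hKim25u`, OPEN; ANY reduction at `3`, so good ordinary OR
supersingular, `a_3 ∈ {0, ±3}` alike); GZK; modularity; the period transfer DISCHARGED (`h3per`);
`3 ∤ c_D`. Class-agnostic; per pair; NOT a class theorem. [claim: Kim2025RefinedTNC, status: under-review]
[cite: Kim2025RefinedTNC, Thm. 1.1 ("BSD"), Thm. 1.2 (rk0), Cor. 1.7 (ANNOUNCED, OPEN binder)]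
[cite: Sakamoto2024KolyvaginThree, Thm. 1.1 = Thm. 4.4 (p. 920)] [cite: Miller2011LMS, Def. 1.1] -/
theorem GoodThree.bsdp_iff_not_dvd_tamagawaProduct_of_kim2025_OPEN_of_kuriharaUnitAt
    (hKim25u : Kim2025.rankZero_padicValRat_sha_of_kuriharaNumber_ne_zero_of_towerSurj_OPEN)
    (hGZK : rank_eq_analyticRank_of_analyticRank_le_one) (hmod : hasEntireLFunction_rat)
    (h3per : realPeriodRat_eq_unit_mul_plusPeriod_three)
    (hr : W.analyticRank = 0) (hgood : W.HasGoodReductionAtPrime 3) (hirr : Irr W 3)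
    (htower : ∀ n : ℕ, W.HasSurjectiveModNGaloisRep (3 ^ n : ℕ))
    {N : ℕ} [NeZero N] (D : ModularParametrizationData W N) (hc : ¬ (3 : ℤ) ∣ D.maninConstant)
    (hK : X4.KuriharaUnitAt W 3 D.f) : BSDp W 3 ↔ ¬ 3 ∣ W.tamagawaProduct := by
  obtain ⟨n, hn0, hn, hcyc, ψ, hψ, hδ⟩ := hK
  exact bsdp_iff_not_dvd_tamagawaProduct_of_kim2025_OPEN_rankZero W 3 hKim25u hGZK le_rfl htower
    ((W.analyticRank_eq_zero_iff_holds (hmod W)).mp hr) D hc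
    (GoodThree.periodTransfer W h3per hgood hirr D.f D.isNewformOf) n hn hcyc ψ hψ hδ

/-- **Good `3`, `E[3]` irreducible, `r_an = 0`, tower, `3 ∤ c_D · ∏ c_ℓ`: `BSD(E,3)` and
`MissingPPartAt W 3` from ONE unit Kurihara number**, whatever `ord₃ #Ш_an` is; CONDITIONAL on
`hKim25u` (OPEN). Class-agnostic; per pair. [claim: Kim2025RefinedTNC, status: under-review]
[cite: Kim2025RefinedTNC, Thm. 1.1, Cor. 1.7 (ANNOUNCED, OPEN binder)] [cite: Miller2011LMS, Def. 1.1] -/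
theorem GoodThree.bsdp_of_kim2025_OPEN_of_kuriharaUnitAt
    (hKim25u : Kim2025.rankZero_padicValRat_sha_of_kuriharaNumber_ne_zero_of_towerSurj_OPEN)
    (hGZK : rank_eq_analyticRank_of_analyticRank_le_one) (hmod : hasEntireLFunction_rat)
    (h3per : realPeriodRat_eq_unit_mul_plusPeriod_three)
    (hr : W.analyticRank = 0) (hgood : W.HasGoodReductionAtPrime 3) (hirr : Irr W 3)
    (htower : ∀ n : ℕ, W.HasSurjectiveModNGaloisRep (3 ^ n : ℕ))
    {N : ℕ} [NeZero N] (D : ModularParametrizationData W N) (hc : ¬ (3 : ℤ) ∣ D.maninConstant)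
    (htam : ¬ 3 ∣ W.tamagawaProduct) (hK : X4.KuriharaUnitAt W 3 D.f) :
    BSDp W 3 ∧ MissingPPartAt W 3 := by
  have hB : BSDp W 3 :=
    (GoodThree.bsdp_iff_not_dvd_tamagawaProduct_of_kim2025_OPEN_of_kuriharaUnitAt W hKim25u hGZK hmod
      h3per hr hgood hirr htower D hc hK).mpr htam
  haveI : Finite W.sha := (hGZK W (by rw [hr]; exact zero_le_one)).2
  exact ⟨hB, missingPPartAt_of_bsdp W 3 hB⟩

/-- **Good `3`, `E[3]` irreducible, `r_an = 1`, tower: `#Ш(E/ℚ)(3) = 1` from ONE unit Kurihara number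
at a PRIME Kolyvagin level** (`X4.KuriharaUnitPrimeAt W 3 D.f`), CONDITIONAL on the announced Kim 2025
Thm. 1.1 rank-one clause (`hKim25r`, OPEN); GZK; the period transfer DISCHARGED; `3 ∤ c_D`.
Class-agnostic; per pair. [claim: Kim2025RefinedTNC, status: under-review]
[cite: Kim2025RefinedTNC, Thm. 1.1 (Str)/("BSD") (ANNOUNCED, OPEN binder)]
[cite: Sakamoto2024KolyvaginThree, Thm. 1.1 = Thm. 4.4 (p. 920)] -/
theorem GoodThree.card_sha_eq_one_of_kim2025_OPEN_of_kuriharaUnitPrimeAt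
    (hKim25r : Kim2025.rankOne_card_sha_eq_one_of_kuriharaNumber_ne_zero_of_towerSurj_OPEN)
    (hGZK : rank_eq_analyticRank_of_analyticRank_le_one)
    (h3per : realPeriodRat_eq_unit_mul_plusPeriod_three)
    (hr : W.analyticRank = 1) (hgood : W.HasGoodReductionAtPrime 3) (hirr : Irr W 3)
    (htower : ∀ n : ℕ, W.HasSurjectiveModNGaloisRep (3 ^ n : ℕ))
    {N : ℕ} [NeZero N] (D : ModularParametrizationData W N) (hc : ¬ (3 : ℤ) ∣ D.maninConstant)
    (hK : X4.KuriharaUnitPrimeAt W 3 D.f) :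
    Nat.card (AddCommGroup.primaryComponent W.sha 3) = 1 := by
  obtain ⟨ℓ, hℓF, hℓ, hcyc, ψ, hψ, hδ⟩ := hK
  obtain ⟨-, hfin⟩ := hGZK W (by rw [hr])
  have hL : W.entireLFunction 1 = 0 := by
    by_contra hL
    have h0 := analyticRank_eq_zero_of_entireLFunction_one_ne_zero hL
    omega
  exact hKim25r W 3 le_rfl htower hL hr hfin D hc
    (GoodThree.periodTransfer W h3per hgood hirr D.f D.isNewformOf) ℓ hℓ hcyc ψ hψ hδ

/-- **Good `3`, `E[3]` irreducible, `r_an = 1`, tower: `BSD(E,3) ⟺ ord₃ #Ш_an = 0`** given a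
prime-level unit Kurihara number and `#Ш_an = q`, CONDITIONAL on `hKim25r` (OPEN). Per pair.
[claim: Kim2025RefinedTNC, status: under-review] [cite: Kim2025RefinedTNC, Thm. 1.1 (ANNOUNCED, OPEN binder)]
[cite: Miller2011LMS, Def. 1.1] -/
theorem GoodThree.bsdp_iff_padicValRat_eq_zero_of_kim2025_OPEN_of_kuriharaUnitPrimeAt
    (hKim25r : Kim2025.rankOne_card_sha_eq_one_of_kuriharaNumber_ne_zero_of_towerSurj_OPEN)
    (hGZK : rank_eq_analyticRank_of_analyticRank_le_one)
    (h3per : realPeriodRat_eq_unit_mul_plusPeriod_three)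
    (hr : W.analyticRank = 1) (hgood : W.HasGoodReductionAtPrime 3) (hirr : Irr W 3)
    (htower : ∀ n : ℕ, W.HasSurjectiveModNGaloisRep (3 ^ n : ℕ))
    {N : ℕ} [NeZero N] (D : ModularParametrizationData W N) (hc : ¬ (3 : ℤ) ∣ D.maninConstant)
    (hK : X4.KuriharaUnitPrimeAt W 3 D.f) {q : ℚ} (hq : shaAn W = (q : ℂ)) :
    BSDp W 3 ↔ padicValRat 3 q = 0 := by
  obtain ⟨hmw, hfin⟩ := hGZK W (by rw [hr])
  exact X4.bsdp_iff_padicValRat_eq_zero_of_card_primaryComponent_eq_one W 3 hmw hfin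
    (GoodThree.card_sha_eq_one_of_kim2025_OPEN_of_kuriharaUnitPrimeAt W hKim25r hGZK h3per hr hgood
      hirr htower D hc hK) hq

/-! ### §1 X7 at `p = 3` (`a_3 = 0`, good supersingular, `E` NOT semistable): N5@3 / O4@3 rows -/

/-- **X7@3 ∧ `r_an = 0` ∧ surj(3) ∧ (ram@3) ∧ `3 ∤ c_D · ∏ c_ℓ`: `BSD(E,3)` from ONE unit Kurihara
number**, CONDITIONAL on `hKim25u` (OPEN); `E[3]` irreducible by `ClassX7.irr` (Serre Prop. 12), the
tower by Serre's transvection lifting from (ram@3). First Kurihara reading of X7 at `p = 3` (x10b's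
`X7KuriharaRoute.lean` is `p ≥ 5`). Per pair; NOT a class theorem; nothing booked.
[claim: Kim2025RefinedTNC, status: under-review] [cite: Kim2025RefinedTNC, Thm. 1.1, Cor. 1.7 (ANNOUNCED, OPEN binder)]
[cite: Serre1972, §1.11 Prop. 12] [cite: SerreAbelianLadic1968, Ch. IV §3.4 and A.1.2] [cite: Miller2011LMS, Def. 1.1] -/
theorem X7.bsdp_three_of_kim2025_OPEN_of_kuriharaUnitAt_of_ram
    (hKim25u : Kim2025.rankZero_padicValRat_sha_of_kuriharaNumber_ne_zero_of_towerSurj_OPEN)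
    (hGZK : rank_eq_analyticRank_of_analyticRank_le_one) (hmod : hasEntireLFunction_rat)
    (h3per : realPeriodRat_eq_unit_mul_plusPeriod_three)
    (hr : W.analyticRank = 0) (hX : ClassX7 W 3) (hs : Surj W 3) (hram : Ram W 3)
    {N : ℕ} [NeZero N] (D : ModularParametrizationData W N) (hc : ¬ (3 : ℤ) ∣ D.maninConstant)
    (htam : ¬ 3 ∣ W.tamagawaProduct) (hK : X4.KuriharaUnitAt W 3 D.f) : BSDp W 3 :=
  (GoodThree.bsdp_of_kim2025_OPEN_of_kuriharaUnitAt W hKim25u hGZK hmod h3per hr hX.1.1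
    (ClassX7.irr W 3 (by decide) hX) (towerSurj_of_surj_of_ram W 3 hs hram) D hc htam hK).1

/-- **X7@3 ∧ `r_an = 0` ∧ surj(3) + ONE Frobenius mod `9` ∧ `3 ∤ c_D · ∏ c_ℓ`: `BSD(E,3)` from ONE
unit Kurihara number**, CONDITIONAL on `hKim25u` (OPEN). Per pair. [claim: Kim2025RefinedTNC, status: under-review]
[cite: Kim2025RefinedTNC, Thm. 1.1, Cor. 1.7 (ANNOUNCED, OPEN binder)] [cite: SerreAbelianLadic1968, Ch. IV §3.4, Lemma 3 (IV-23)]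
[cite: Miller2011LMS, Def. 1.1] -/
theorem X7.bsdp_three_of_kim2025_OPEN_of_kuriharaUnitAt_of_frobenius
    (hKim25u : Kim2025.rankZero_padicValRat_sha_of_kuriharaNumber_ne_zero_of_towerSurj_OPEN)
    (hGZK : rank_eq_analyticRank_of_analyticRank_le_one) (hmod : hasEntireLFunction_rat)
    (h3per : realPeriodRat_eq_unit_mul_plusPeriod_three)
    (hr : W.analyticRank = 0) (hX : ClassX7 W 3) (hs : Surj W 3)
    (ℓ : ℕ) [Fact ℓ.Prime] (hgood : W.HasGoodReductionAtPrime ℓ)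
    (hℓ9 : ℓ % 9 = 2 ∨ ℓ % 9 = 5) (ha9 : W.frobeniusTrace ℓ % 9 = 3 ∨ W.frobeniusTrace ℓ % 9 = 6)
    {N : ℕ} [NeZero N] (D : ModularParametrizationData W N) (hc : ¬ (3 : ℤ) ∣ D.maninConstant)
    (htam : ¬ 3 ∣ W.tamagawaProduct) (hK : X4.KuriharaUnitAt W 3 D.f) : BSDp W 3 :=
  (GoodThree.bsdp_of_kim2025_OPEN_of_kuriharaUnitAt W hKim25u hGZK hmod h3per hr hX.1.1
    (ClassX7.irr W 3 (by decide) hX) (towerSurj_of_frobenius_of_eq_three W 3 rfl hs ℓ hgood hℓ9 ha9)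
    D hc htam hK).1

/-- **X7@3 ∧ `r_an = 1` ∧ surj(3) ∧ (ram@3) ∧ `3 ∤ c_D`: `#Ш(E/ℚ)(3) = 1` from ONE unit Kurihara
number at a Kolyvagin prime**, CONDITIONAL on `hKim25r` (OPEN) — the currency of the lane's exact
`3`-descent records on O4@3, from a third instrument. Per pair; nothing booked.
[claim: Kim2025RefinedTNC, status: under-review] [cite: Kim2025RefinedTNC, Thm. 1.1 (ANNOUNCED, OPEN binder)]
[cite: Serre1972, §1.11 Prop. 12] [cite: SerreAbelianLadic1968, Ch. IV §3.4 and A.1.2] -/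
theorem X7.card_sha_three_eq_one_of_kim2025_OPEN_of_kuriharaUnitPrimeAt_of_ram
    (hKim25r : Kim2025.rankOne_card_sha_eq_one_of_kuriharaNumber_ne_zero_of_towerSurj_OPEN)
    (hGZK : rank_eq_analyticRank_of_analyticRank_le_one)
    (h3per : realPeriodRat_eq_unit_mul_plusPeriod_three)
    (hr : W.analyticRank = 1) (hX : ClassX7 W 3) (hs : Surj W 3) (hram : Ram W 3)
    {N : ℕ} [NeZero N] (D : ModularParametrizationData W N) (hc : ¬ (3 : ℤ) ∣ D.maninConstant)
    (hK : X4.KuriharaUnitPrimeAt W 3 D.f) :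
    Nat.card (AddCommGroup.primaryComponent W.sha 3) = 1 :=
  GoodThree.card_sha_eq_one_of_kim2025_OPEN_of_kuriharaUnitPrimeAt W hKim25r hGZK h3per hr hX.1.1
    (ClassX7.irr W 3 (by decide) hX) (towerSurj_of_surj_of_ram W 3 hs hram) D hc hK

/-- **X7@3 ∧ `r_an = 1` ∧ surj(3) + ONE Frobenius mod `9` ∧ `3 ∤ c_D`: `#Ш(E/ℚ)(3) = 1` from ONE
unit Kurihara number at a Kolyvagin prime**, CONDITIONAL on `hKim25r` (OPEN). Per pair.
[claim: Kim2025RefinedTNC, status: under-review] [cite: Kim2025RefinedTNC, Thm. 1.1 (ANNOUNCED, OPEN binder)]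
[cite: SerreAbelianLadic1968, Ch. IV §3.4, Lemma 3 (IV-23)] -/
theorem X7.card_sha_three_eq_one_of_kim2025_OPEN_of_kuriharaUnitPrimeAt_of_frobenius
    (hKim25r : Kim2025.rankOne_card_sha_eq_one_of_kuriharaNumber_ne_zero_of_towerSurj_OPEN)
    (hGZK : rank_eq_analyticRank_of_analyticRank_le_one)
    (h3per : realPeriodRat_eq_unit_mul_plusPeriod_three)
    (hr : W.analyticRank = 1) (hX : ClassX7 W 3) (hs : Surj W 3)
    (ℓ : ℕ) [Fact ℓ.Prime] (hgood : W.HasGoodReductionAtPrime ℓ)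
    (hℓ9 : ℓ % 9 = 2 ∨ ℓ % 9 = 5) (ha9 : W.frobeniusTrace ℓ % 9 = 3 ∨ W.frobeniusTrace ℓ % 9 = 6)
    {N : ℕ} [NeZero N] (D : ModularParametrizationData W N) (hc : ¬ (3 : ℤ) ∣ D.maninConstant)
    (hK : X4.KuriharaUnitPrimeAt W 3 D.f) :
    Nat.card (AddCommGroup.primaryComponent W.sha 3) = 1 :=
  GoodThree.card_sha_eq_one_of_kim2025_OPEN_of_kuriharaUnitPrimeAt W hKim25r hGZK h3per hr hX.1.1
    (ClassX7.irr W 3 (by decide) hX) (towerSurj_of_frobenius_of_eq_three W 3 rfl hs ℓ hgood hℓ9 ha9)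
    D hc hK

/-! ### §2 X6 at `p = 3` (`a_3 = 0`, semistable): the tower with NO certificate (Serre Prop. 21 i) +
Ribet–Diamond level-lowering + transvection lifting): N4@3 rows -/

/-- **X6@3 ∧ `r_an = 0` ∧ `3 ∤ c_D · ∏ c_ℓ`: `BSD(E,3)` from ONE unit Kurihara number**, CONDITIONAL on
`hKim25u` (OPEN); surj(3) automatic (`ClassX6.surj`), (ram@3) by modularity `hmod'` + refined Serre
`hLL` (`ram_of_semistable_of_irr_of_le_seven`), hence the `3`-adic tower with no certificate. Per pair;
nothing booked. [claim: Kim2025RefinedTNC, status: under-review]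
[cite: Kim2025RefinedTNC, Thm. 1.1, Cor. 1.7 (ANNOUNCED, OPEN binder)] [cite: Ribet1990, Thm. 1.1]
[cite: Diamond1995RefinedSerre, Thm. 1.1] [cite: Serre1972, §5.4 Prop. 21 i)] [cite: Miller2011LMS, Def. 1.1] -/
theorem X6.bsdp_three_of_kim2025_OPEN_of_kuriharaUnitAt_of_levelLowering
    (hKim25u : Kim2025.rankZero_padicValRat_sha_of_kuriharaNumber_ne_zero_of_towerSurj_OPEN)
    (hGZK : rank_eq_analyticRank_of_analyticRank_le_one) (hmod : hasEntireLFunction_rat)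
    (h3per : realPeriodRat_eq_unit_mul_plusPeriod_three)
    (hmod' : exists_isNewformOf) (hLL : Literature.NumberTheory.Automorphic.diamond1995_refinedSerre)
    (hr : W.analyticRank = 0) (hX : ClassX6 W 3)
    {N : ℕ} [NeZero N] (D : ModularParametrizationData W N) (hc : ¬ (3 : ℤ) ∣ D.maninConstant)
    (htam : ¬ 3 ∣ W.tamagawaProduct) (hK : X4.KuriharaUnitAt W 3 D.f) : BSDp W 3 :=
  have hirr : Irr W 3 := ClassX6.irr W 3 (by decide) hX
  (GoodThree.bsdp_of_kim2025_OPEN_of_kuriharaUnitAt W hKim25u hGZK hmod h3per hr hX.1.1 hirr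
    (towerSurj_of_surj_of_ram W 3 (ClassX6.surj W 3 (by decide) hX)
      (ram_of_semistable_of_irr_of_le_seven hmod' hLL W 3 (by decide) (by decide) hX.2.1 hirr))
    D hc htam hK).1

/-- **X6@3 ∧ `r_an = 1` ∧ `3 ∤ c_D`: `#Ш(E/ℚ)(3) = 1` from ONE unit Kurihara number at a Kolyvagin
prime**, CONDITIONAL on `hKim25r` (OPEN); tower with no certificate as above. (X6 ∧ `r_an = 1` is not
residual — JSW / Sprung 2024 Cor. 1.3 + unit `#Ш_an` —; recorded for the instrument's calibration rows.)
Per pair. [claim: Kim2025RefinedTNC, status: under-review] [cite: Kim2025RefinedTNC, Thm. 1.1 (ANNOUNCED, OPEN binder)]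
[cite: Ribet1990, Thm. 1.1] [cite: Diamond1995RefinedSerre, Thm. 1.1] [cite: Serre1972, §5.4 Prop. 21 i)] -/
theorem X6.card_sha_three_eq_one_of_kim2025_OPEN_of_kuriharaUnitPrimeAt_of_levelLowering
    (hKim25r : Kim2025.rankOne_card_sha_eq_one_of_kuriharaNumber_ne_zero_of_towerSurj_OPEN)
    (hGZK : rank_eq_analyticRank_of_analyticRank_le_one)
    (h3per : realPeriodRat_eq_unit_mul_plusPeriod_three)
    (hmod' : exists_isNewformOf) (hLL : Literature.NumberTheory.Automorphic.diamond1995_refinedSerre)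
    (hr : W.analyticRank = 1) (hX : ClassX6 W 3)
    {N : ℕ} [NeZero N] (D : ModularParametrizationData W N) (hc : ¬ (3 : ℤ) ∣ D.maninConstant)
    (hK : X4.KuriharaUnitPrimeAt W 3 D.f) :
    Nat.card (AddCommGroup.primaryComponent W.sha 3) = 1 :=
  have hirr : Irr W 3 := ClassX6.irr W 3 (by decide) hX
  GoodThree.card_sha_eq_one_of_kim2025_OPEN_of_kuriharaUnitPrimeAt W hKim25r hGZK h3per hr hX.1.1 hirr
    (towerSurj_of_surj_of_ram W 3 (ClassX6.surj W 3 (by decide) hX)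
      (ram_of_semistable_of_irr_of_le_seven hmod' hLL W 3 (by decide) (by decide) hX.2.1 hirr))
    D hc hK

/-! ### §3 APPEND (gen 17): the Manin binder at a good `3` for the OPTIMAL parametrisation — Mazur
1978 Cor. 4.1, NO degree bit (census, Cremona `alldegphi`: `3 ∣ deg φ` on 86 of N6's 101 surj ∧ `3 ∤ ∏c_ℓ`
cells, on 19 of O3's 21, on 96 of N5@3's 99 — so the CNS form of §0 reaches few rows, Mazur's reaches
every optimal curve; non-optimal members then follow by Cassels' isogeny invariance of `BSD(E,p)`) -/

omit [W.IsGloballyMinimal] in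
/-- **At a prime of good reduction `3 ∤ N(E)`** (`f₃ = 0`, Silverman ATAEC IV.10.2(a), through the tree's
`conductorExponent_eq_zero_of_hasGoodReductionAt` and `not_pow_dvd_conductorNorm_of_condExp_lt`).
[cite: Silverman1994, IV.10.2(a)] -/
theorem GoodThree.not_three_dvd_conductorNorm (hgood : W.HasGoodReductionAtPrime 3) :
    ¬ 3 ∣ W.conductorNorm ℤ := by
  have hv : W.HasGoodReductionAt (placeOf 3) :=
    (W.hasGoodReductionAtPrime_iff_hasGoodReductionAt_holds ⟨3, Nat.prime_three⟩).mp hgood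
  have h0 : condExp W 3 = 0 := conductorExponent_eq_zero_of_hasGoodReductionAt (placeOf 3) W hv
  have h := not_pow_dvd_conductorNorm_of_condExp_lt W 3 (k := 1) (by rw [h0]; exact Nat.one_pos)
  simpa using h

/-- **The Manin binder for an OPTIMAL parametrisation at a good `3`: `3 ∤ c(D)`** — Mazur 1978 Cor. 4.1
(named fact `hMazur` = `mazur_not_dvd_maninConstant_of_odd`: `p` odd, `p² ∤ N'`, `Λ_E ⊆ c·Λ_f` ⇒ `p ∤ c`),
the level `N'` of the newform of `W` being prime to `3` because the conductor is
(`IsNewformOf.dvd_level_iff_dvd_conductorNorm`, `GoodThree.not_three_dvd_conductorNorm`). The optimality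
relation `hopt` is the datum Cremona's tables record (optimal curve, `c = 1`); no degree bit is needed.
[cite: Mazur1978, Cor. 4.1] [cite: EdixhovenManin1991, Prop. 2 and §1] -/
theorem GoodThree.not_three_dvd_maninConstant_of_optimal (hMazur : mazur_not_dvd_maninConstant_of_odd)
    (hgood : W.HasGoodReductionAtPrime 3) {N' : ℕ} [NeZero N'] (D : ModularParametrizationData W N')
    (hopt : ∀ z ∈ D.L.lattice, ∃ w ∈ periodLattice D.f, z = D.c * w) : ¬ (3 : ℤ) ∣ D.maninConstant := by
  refine hMazur W D hopt 3 Nat.prime_three (by decide) ?_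
  intro h9
  have h3 : 3 ∣ N' := dvd_trans (dvd_pow_self 3 two_ne_zero) h9
  exact GoodThree.not_three_dvd_conductorNorm W hgood
    ((D.isNewformOf.dvd_level_iff_dvd_conductorNorm Nat.prime_three).mp h3)

/-- **Good `3`, `E[3]` irreducible, `r_an = 0`, tower, OPTIMAL datum, `3 ∤ ∏ c_ℓ`: `BSD(E,3)` from ONE unit
Kurihara number** — the Manin binder DISCHARGED by Mazur 1978 Cor. 4.1 (`hMazur`) instead of the degree,
CONDITIONAL on `hKim25u` (OPEN). Class-agnostic (X8 / X7@3 / X6@3 alike); per pair; nothing booked.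
[claim: Kim2025RefinedTNC, status: under-review] [cite: Kim2025RefinedTNC, Thm. 1.1, Cor. 1.7 (ANNOUNCED, OPEN binder)]
[cite: Mazur1978, Cor. 4.1] [cite: Miller2011LMS, Def. 1.1] -/
theorem GoodThree.bsdp_of_kim2025_OPEN_of_kuriharaUnitAt_of_optimal
    (hKim25u : Kim2025.rankZero_padicValRat_sha_of_kuriharaNumber_ne_zero_of_towerSurj_OPEN)
    (hMazur : mazur_not_dvd_maninConstant_of_odd)
    (hGZK : rank_eq_analyticRank_of_analyticRank_le_one) (hmod : hasEntireLFunction_rat)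
    (h3per : realPeriodRat_eq_unit_mul_plusPeriod_three)
    (hr : W.analyticRank = 0) (hgood : W.HasGoodReductionAtPrime 3) (hirr : Irr W 3)
    (htower : ∀ n : ℕ, W.HasSurjectiveModNGaloisRep (3 ^ n : ℕ))
    {N' : ℕ} [NeZero N'] (D : ModularParametrizationData W N')
    (hopt : ∀ z ∈ D.L.lattice, ∃ w ∈ periodLattice D.f, z = D.c * w)
    (htam : ¬ 3 ∣ W.tamagawaProduct) (hK : X4.KuriharaUnitAt W 3 D.f) : BSDp W 3 :=
  (GoodThree.bsdp_of_kim2025_OPEN_of_kuriharaUnitAt W hKim25u hGZK hmod h3per hr hgood hirr htower D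
    (GoodThree.not_three_dvd_maninConstant_of_optimal W hMazur hgood D hopt) htam hK).1

/-- **Good `3`, `E[3]` irreducible, `r_an = 1`, tower, OPTIMAL datum: `#Ш(E/ℚ)(3) = 1` from ONE unit
Kurihara number at a Kolyvagin prime** — Manin binder by Mazur 1978 Cor. 4.1 (`hMazur`); CONDITIONAL on
`hKim25r` (OPEN). Class-agnostic; per pair. [claim: Kim2025RefinedTNC, status: under-review]
[cite: Kim2025RefinedTNC, Thm. 1.1 (ANNOUNCED, OPEN binder)] [cite: Mazur1978, Cor. 4.1] -/
theorem GoodThree.card_sha_eq_one_of_kim2025_OPEN_of_kuriharaUnitPrimeAt_of_optimal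
    (hKim25r : Kim2025.rankOne_card_sha_eq_one_of_kuriharaNumber_ne_zero_of_towerSurj_OPEN)
    (hMazur : mazur_not_dvd_maninConstant_of_odd)
    (hGZK : rank_eq_analyticRank_of_analyticRank_le_one)
    (h3per : realPeriodRat_eq_unit_mul_plusPeriod_three)
    (hr : W.analyticRank = 1) (hgood : W.HasGoodReductionAtPrime 3) (hirr : Irr W 3)
    (htower : ∀ n : ℕ, W.HasSurjectiveModNGaloisRep (3 ^ n : ℕ))
    {N' : ℕ} [NeZero N'] (D : ModularParametrizationData W N')
    (hopt : ∀ z ∈ D.L.lattice, ∃ w ∈ periodLattice D.f, z = D.c * w)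
    (hK : X4.KuriharaUnitPrimeAt W 3 D.f) :
    Nat.card (AddCommGroup.primaryComponent W.sha 3) = 1 :=
  GoodThree.card_sha_eq_one_of_kim2025_OPEN_of_kuriharaUnitPrimeAt W hKim25r hGZK h3per hr hgood hirr
    htower D (GoodThree.not_three_dvd_maninConstant_of_optimal W hMazur hgood D hopt) hK

end Summit.BirchSwinnertonDyer.Rank1Residual.Supersingular

end
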